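import Summits.ValiantsHypothesis.ValiantsHypothesis.Theorems.TwoProducts.RankThreeAffineOLMColumns

/-!
# OLM slot, column ladder part 2: the CANONICAL ladder and its ψ-FREE RESIDUE — «OLM columns law ⟸ (TW-count)» as a typed sentence

Part 1 (✓ `…RankThreeAffineOLMColumns`, p710727) crushes the residue term `|Eset σ Φ_p|` of each column step by support counting (`t^{O(5^K)}`).  THIS FILE
keeps it (val-idea-crit-8 g5 #85 (L2) / #90 (C1)–(C5)): with the CANONICAL pivot order (`Fin K` order; a vanished pivot column is skipped INSIDE the
recursion, not assumed away) the column functions `canCol u e j i` — the `j`-th iterated toric bracket of the monomial `X^{e_i}` against `u` — depend on `u`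
and `e` ONLY (ψ-FREE on the nose), and
★★ `card_Eset_columnSum_le_residue` (UNCONDITIONAL, all ψ): `|Eset σ (Σ_i X^{e_i}·ψ_i(u))| ≤ 3K·|Xc σ u| + 3K + 3·colResidue σ u e`,
`colResidue σ u e := Σ_{j<K} |Eset σ (canCol u e j j)|`.  Hence ★ `olmColumns_nv_le_of_twCount`: any bound `Q K t` on the edge directions of the canonical
pivot columns — the HYPOTHESIS SHAPE `TWCountBound Q` (NOT asserted here; a `def … : Prop` like ✓ `ShiftedAxialBound`) — gives
`nv ≤ 2·(3K(t²+t) + 3K + 3K·Q K t) + 4` for ALL columns ψ; polynomial in `(K,t)` iff `Q` is, and `K ≤ (m+1)(m+2)/2` in the OLM slot (`OLMLaw` itself is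
typed by val-idea-35 g11 in the Cruxes workfile and is not restated here).  DATA SENTENCE (data, NOT evidence on a ∀-statement): in every exact
computation of the scratch report 44e1e76fa8779622 (`w6–w10.py`, K ≤ 6, t ≤ 7, incl. ray-aligned / nested-resonance designs) the pivot columns have
≤ 9 edge directions while their supports reach 2 234 monomials.
OUTLOOK (prose, crit-8 #90 (C5); a separate sig-first once ✓): with val-port-1 g5's S2 `wronskian_sylvester` (Sylvester's identity for the Wronskian of an
arbitrary derivation, `newCol(W(f⃗,g), W(f⃗,h)) = W(f⃗)·W(f⃗,g,h)` for `D = jacDer u`) the pivot column `canCol u e j j` is a product of FLAG toric Wronskians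
`W_{J(·,u)}(X^{e_0},…,X^{e_l})`, `l ≤ j+1`, so by ✓ `ostrowski` `colResidue ≤ (K+1)·Σ_l |Eset σ W_l|` and (TW-count) becomes «flag toric Wronskians of monomials
are tame» — proved on non-resonant arcs (Vandermonde top) and for a single resonant class (`W = X^{re} z^{Σn} ε^{C(r,2)} VdM(n)`), OPEN at merged resonances.
HONEST LABEL: bookkeeping / typed reduction on the OPEN rung 3-AFF (side ladder «table-rank-ladder», crux `stmt-ValiantsHypothesis-5906` `TwoProducts`);
(TW-count) is NOT proved; NOT γ; `OLMLaw` / `RankThreeAffineLaw(Exp)` / `LevelOneLaw` / `TwoProducts` / PCB / `ResidualLawV25` UNMOVED; 0 summit distance;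
VP ≠ VNP is NOT proved.  `--kind definition --supports stmt-ValiantsHypothesis-5906 --as helper` (val-port-4 g5; critic of record val-idea-crit-8 g5).
No instances, no notation, no named facts. [folklore]
-/

noncomputable section
set_option linter.dupNamespace false

namespace Summit.ValiantsHypothesis.ValiantsHypothesis.Theorems.TwoProducts.RankTwoJacobian

open scoped BigOperators Pointwise
open MvPolynomial

section TowerKernel
open scoped Classical

/-- the CANONICAL column functions: `canCol u e 0 i = X^{e_i}`; at step `j` the pivot is column `j` (skipped if its function vanished):
`canCol u e (j+1) i = newCol u (canCol u e j j) (canCol u e j i)` (or unchanged). ψ-FREE: depends on `u` and `e` only. -/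
def canCol {K : ℕ} (u : Poly2) (e : Fin K → Expo) : ℕ → Fin K → Poly2
  | 0, i => monomial (e i) 1
  | j + 1, i => if ∃ hj : j < K, canCol u e j ⟨j, hj⟩ = 0 then canCol u e j i
      else if hj : j < K then newCol u (canCol u e j ⟨j, hj⟩) (canCol u e j i) else canCol u e j i

/-- the ψ-FREE RESIDUE of the canonical ladder in the chart `σ`: `Σ_{j<K} |Eset σ (canCol u e j j)|`. -/
def colResidue (σ : ℝ) {K : ℕ} (u : Poly2) (e : Fin K → Expo) : ℕ :=
  ∑ j : Fin K, (Eset σ (canCol u e j j)).card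

/-- the canonical ladder, step `j`: the columns `≥ j` that remain. [folklore] -/
theorem olmColumns_canonical_from {σ : ℝ} (hσ : σ = 1 ∨ σ = -1) {K : ℕ} {u : Poly2} (hS : (S1 u).Nonempty)
    (e : Fin K → Expo) (ψ : Fin K → Polynomial ℂ) :
    ∀ (n j : ℕ), j + n = K →
      (Eset σ (∑ i ∈ Finset.univ.filter (fun i : Fin K => j ≤ (i : ℕ)), canCol u e j i * Polynomial.aeval u (ψ i))).card ≤
        3 * n * (Xc σ u).card + 3 * n + 3 * ∑ i ∈ Finset.univ.filter (fun i : Fin K => j ≤ (i : ℕ)), (Eset σ (canCol u e i i)).card := by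
  intro n
  induction n with
  | zero =>
    intro j hj
    have hempty : Finset.univ.filter (fun i : Fin K => j ≤ (i : ℕ)) = ∅ := by
      refine Finset.eq_empty_of_forall_notMem fun i hi => ?_
      have := (Finset.mem_filter.mp hi).2
      have := i.isLt
      omega
    rw [hempty, Finset.sum_empty, Eset_zero]
    simp
  | succ n ih =>
    intro j hj
    have hjK : j < K := by omega
    set I := Finset.univ.filter (fun i : Fin K => j ≤ (i : ℕ)) with hI
    set I' := Finset.univ.filter (fun i : Fin K => j + 1 ≤ (i : ℕ)) with hI'
    have hjI : (⟨j, hjK⟩ : Fin K) ∈ I := Finset.mem_filter.mpr ⟨Finset.mem_univ _, le_refl _⟩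
    have hII' : I.erase ⟨j, hjK⟩ = I' := by
      ext i
      simp only [hI, hI', Finset.mem_erase, Finset.mem_filter, Finset.mem_univ, true_and]
      constructor
      · rintro ⟨hne, hle⟩
        have : (i : ℕ) ≠ j := fun h => hne (Fin.ext h)
        omega
      · intro h
        refine ⟨fun h' => ?_, by omega⟩
        rw [h'] at h; simp at h
    have ih' := ih (j + 1) (by omega)
    rw [← hI'] at ih'
    -- the residue sum over `I` splits off the `j`-th term
    have hres : ∑ i ∈ I, (Eset σ (canCol u e i i)).card =
        (Eset σ (canCol u e j ⟨j, hjK⟩)).card + ∑ i ∈ I', (Eset σ (canCol u e i i)).card := by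
      rw [← Finset.add_sum_erase I _ hjI, hII']
    by_cases h0 : canCol u e j ⟨j, hjK⟩ = 0
    · -- vanished pivot: the `j`-th term is absent and the column functions are unchanged
      have hstep : ∀ i, canCol u e (j + 1) i = canCol u e j i := by
        intro i
        show (if ∃ hj : j < K, canCol u e j ⟨j, hj⟩ = 0 then canCol u e j i
          else if hj : j < K then newCol u (canCol u e j ⟨j, hj⟩) (canCol u e j i) else canCol u e j i) = canCol u e j i
        rw [if_pos ⟨hjK, h0⟩]
      have hsum : ∑ i ∈ I, canCol u e j i * Polynomial.aeval u (ψ i) = ∑ i ∈ I', canCol u e (j + 1) i * Polynomial.aeval u (ψ i) := by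
        rw [← Finset.add_sum_erase I _ hjI, hII', h0, zero_mul, zero_add]
        exact Finset.sum_congr rfl fun i _ => by rw [hstep]
      rw [hsum, hres]
      refine ih'.trans ?_
      have hmono : ∑ i ∈ I', (Eset σ (canCol u e i i)).card ≤
          (Eset σ (canCol u e j ⟨j, hjK⟩)).card + ∑ i ∈ I', (Eset σ (canCol u e i i)).card := Nat.le_add_left _ _
      nlinarith [hmono, Nat.zero_le (Xc σ u).card]
    · -- live pivot: one shifted-template step
      have hstep : ∀ i, canCol u e (j + 1) i = newCol u (canCol u e j ⟨j, hjK⟩) (canCol u e j i) := by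
        intro i
        show (if ∃ hj : j < K, canCol u e j ⟨j, hj⟩ = 0 then canCol u e j i
          else if hj : j < K then newCol u (canCol u e j ⟨j, hj⟩) (canCol u e j i) else canCol u e j i) = _
        rw [if_neg (fun ⟨_, h⟩ => h0 h), dif_pos hjK]
      have h1 := card_Eset_column_step_le hσ hS I (canCol u e j) ψ hjI h0
      rw [hII'] at h1
      have hsum : ∑ i ∈ I', newCol u (canCol u e j ⟨j, hjK⟩) (canCol u e j i) * Polynomial.aeval u (ψ i) =
          ∑ i ∈ I', canCol u e (j + 1) i * Polynomial.aeval u (ψ i) :=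
        Finset.sum_congr rfl fun i _ => by rw [hstep]
      rw [hsum] at h1
      rw [hres]
      refine h1.trans ?_
      nlinarith [ih', Nat.zero_le (Xc σ u).card, Nat.zero_le (Eset σ (canCol u e j ⟨j, hjK⟩)).card]

/-- ★★ THE CANONICAL LADDER WITH ITS RESIDUE VISIBLE: for a non-constant `t`-sparse `u`,
`|Eset σ (Σ_i X^{e_i}·ψ_i(u))| ≤ 3K·|Xc σ u| + 3K + 3·colResidue σ u e` for ALL columns `ψ` — the residue is ψ-free. -/
theorem card_Eset_columnSum_le_residue {σ : ℝ} (hσ : σ = 1 ∨ σ = -1) {K : ℕ} {u : Poly2} (hS : (S1 u).Nonempty)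
    (e : Fin K → Expo) (ψ : Fin K → Polynomial ℂ) :
    (Eset σ (∑ i, monomial (e i) (1 : ℂ) * Polynomial.aeval u (ψ i))).card ≤ 3 * K * (Xc σ u).card + 3 * K + 3 * colResidue σ u e := by
  have h := olmColumns_canonical_from hσ hS e ψ K 0 (by omega)
  have hI : Finset.univ.filter (fun i : Fin K => 0 ≤ (i : ℕ)) = Finset.univ := by
    ext i; simp
  rw [hI] at h
  unfold colResidue
  exact h

/-- (TW-count) as a HYPOTHESIS SHAPE (like ✓ `ShiftedAxialBound`; NOT asserted in this file, no data dresses it as a fact): a bound `Q K t` on the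
number of edge directions, per chart, of every canonical pivot column `canCol u e j j` of a `t`-sparse `u`.  The only Prop-`def` of this file. -/
def TWCountBound (Q : ℕ → ℕ → ℕ) : Prop :=
  ∀ (σ : ℝ), (σ = 1 ∨ σ = -1) → ∀ (K t : ℕ) (u : Poly2), u.support.card ≤ t → ∀ (e : Fin K → Expo) (j : Fin K),
    (Eset σ (canCol u e j j)).card ≤ Q K t

/-- ★ **`OLMLaw ⟸ (TW-count)`, typed:** any ψ-free bound `Q` on the canonical column functions gives, for ALL columns `ψ` (any heights),
`nv (Σ_{i<K} X^{e_i}·ψ_i(u)) ≤ 2·(3K(t²+t) + 3K + 3K·Q K t) + 4` — polynomial in `(K,t)` iff `Q` is (`K ≤ (m+1)(m+2)/2` in the OLM slot). -/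
theorem olmColumns_nv_le_of_twCount {Q : ℕ → ℕ → ℕ} (hQ : TWCountBound Q) (K t : ℕ) (u : Poly2) (hu : u.support.card ≤ t)
    (e : Fin K → Expo) (ψ : Fin K → Polynomial ℂ) :
    nv (∑ i, monomial (e i) (1 : ℂ) * Polynomial.aeval u (ψ i)) ≤ 2 * (3 * K * (t * t + t) + 3 * K + 3 * (K * Q K t)) + 4 := by
  by_cases hS : (S1 u).Nonempty
  · have hX : ∀ σ : ℝ, (Xc σ u).card ≤ t * t + t :=
      fun σ => (card_Xc_le σ u).trans (Nat.add_le_add (Nat.mul_le_mul hu hu) hu)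
    have hR : ∀ σ : ℝ, (σ = 1 ∨ σ = -1) → colResidue σ u e ≤ K * Q K t := by
      intro σ hσ
      unfold colResidue
      calc ∑ j : Fin K, (Eset σ (canCol u e j j)).card ≤ ∑ _j : Fin K, Q K t := Finset.sum_le_sum fun j _ => hQ σ hσ K t u hu e j
        _ = K * Q K t := by simp
    have h1 := card_Eset_columnSum_le_residue (σ := 1) (Or.inl rfl) hS e ψ
    have h2 := card_Eset_columnSum_le_residue (σ := -1) (Or.inr rfl) hS e ψ
    have hn := nv_le (∑ i, monomial (e i) (1 : ℂ) * Polynomial.aeval u (ψ i))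
    have a1 := hX 1; have a2 := hX (-1); have r1 := hR 1 (Or.inl rfl); have r2 := hR (-1) (Or.inr rfl)
    have b1 : 3 * K * (Xc 1 u).card ≤ 3 * K * (t * t + t) := Nat.mul_le_mul_left _ a1
    have b2 : 3 * K * (Xc (-1) u).card ≤ 3 * K * (t * t + t) := Nat.mul_le_mul_left _ a2
    omega
  · -- constant carrier: the sum is `Σ_i ψ_i(c)·X^{e_i}` with `≤ K` monomials
    have huC : u = C (coeff 0 u) := eq_C_of_S1_empty hS
    have hval : ∀ i, Polynomial.aeval u (ψ i) = C ((ψ i).eval (coeff 0 u)) := fun i => by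
      rw [show Polynomial.aeval u (ψ i) = Polynomial.aeval (C (coeff 0 u) : Poly2) (ψ i) by rw [← huC]]
      exact aeval_C_eq _ _
    have hsum : ∑ i, monomial (e i) (1 : ℂ) * Polynomial.aeval u (ψ i) =
        ∑ i ∈ Finset.univ, (monomial (e i) ((ψ i).eval (coeff 0 u)) : Poly2) := by
      refine Finset.sum_congr rfl fun i _ => ?_
      rw [hval i, mul_comm, C_mul_monomial, mul_one]
    rw [hsum]
    have hK := (nv_le_card_support _).trans
      (card_support_sum_monomial_le Finset.univ e (fun i => (ψ i).eval (coeff 0 u)))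
    simp only [Finset.card_univ, Fintype.card_fin] at hK
    omega

end TowerKernel

end Summit.ValiantsHypothesis.ValiantsHypothesis.Theorems.TwoProducts.RankTwoJacobian

end
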